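import Summits.Ventures.PercRepro.SixFourPLProfileB
import Summits.Ventures.PercRepro.SixFourPLBridge

/-!
# PercRepro — C-025 at `(6,4)`, §22.12: the plane-line case modulo Theorem 22.12 alone (p3, gen 9)

With profile completeness in the kernel (`profile_mem_LIST`: the coarse profile of every normalised plane-line set is
in `LIST`), the profile-list bound `PLBound` of `SixFourPLBridge.lean` reduces to THEOREM 22.12 proper — the
inequality `J₄(G) ≥ Jlow(π(G))` — stated here as the ordinary `Prop` **`PLJlow`**: for every normalisation
`D : PLData M G` of a plane-line set `G` (simple `M`, rank `4`, plane traces `≤ 7`, `g ≥ 10`),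
`15·Jlow(profile D) ≤ 15·J₄(G)`.  **`sixTwoSix_of_PLJlow : PLJlow → SixTwoSix`**.  So the plane-line case of
Theorem 22 now rests on the single paper lemma 22.12.4 (the identity 22.1 + the plane list 22.12.2 + the lpp
identity 22.2 + Lemma X̄ 22.12.3, assembled), everything else being kernel-checked.
-/

namespace PercRepro.SixFour

open Finset ThmH

/-- **Theorem 22.12 as a hypothesis**: `15·Jlow(π(G)) ≤ 15·J₄(G)` for every normalisation of every plane-line set
(simple `M`, `G ⊆ E` of rank `4`, plane traces `≤ 7`, `10 ≤ g`). -/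
def PLJlow : Prop :=
  ∀ {β : Type} [DecidableEq β] (M : Matroid β) [M.Finite] (G : Finset β), Simple M → G ⊆ gr M →
    M.eRk (G : Set β) = 4 → (∀ P ∈ planes M, (P ∩ G).card ≤ 7) → 10 ≤ G.card →
    ∀ D : PLData M G, (PL.J15 D.profile : ℚ) ≤ 15 * J M G 4

/-- `PLJlow → PLBound`: the profile of a normalisation is in `LIST` (`profile_mem_LIST`) and is the witness. -/
theorem PLBound_of_PLJlow (h : PLJlow) : PLBound := by
  intro β _ M _ G hs hG hr hgen hpl hg _
  obtain ⟨D, -⟩ := exists_PLData hs hG hr hgen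
  exact ⟨D.profile, PLData.profile_mem_LIST hs hG hpl hg, h M G hs hG hr hpl hg D⟩

/-- **`SixTwoSix` from Theorem 22.12 alone**: `PLJlow → SixTwoSix`. -/
theorem sixTwoSix_of_PLJlow (h : PLJlow) : SixTwoSix.{0} :=
  sixTwoSix_of_PLBound (PLBound_of_PLJlow h)

end PercRepro.SixFour
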